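import Summits.MatrixMultiplication.MatrixMultiplication.Theorems.AbelianSTPPCensusTDStatSound
import Summits.MatrixMultiplication.MatrixMultiplication.Theorems.AbelianSTPPCensusTDStatDom
import Summits.MatrixMultiplication.MatrixMultiplication.Theorems.AbelianSTPPCensusTDStatCk
import Summits.MatrixMultiplication.MatrixMultiplication.Theorems.AbelianSTPPCensusLeafTE476Closed
import Summits.MatrixMultiplication.MatrixMultiplication.Theorems.AbelianSTPPCensusLeafSiblingsClosed

/-!
# T_D/627: no abelian STPP host of order `≤ 627` beats `τ = 2.47` (static t*-indexed linear certificate at `τ = 247/100`)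

Cell mm-stpp (rung F-M1), tier T_D = «beat `2.47`, i.e. every abelian STPP construction of the CKSU era»; successor kernel item of the closed crux item
stmt-MatrixMultiplication-19191 (SUCCESSOR-BRIEF RIDER 27 (1): the vp-p2 lane's next kernel number, a T_D column beyond the inherited `476`), seat mm-stpp-vp-p2 (gen 4).
For every finite abelian group `H` with `|H| ≤ 627` and every STPP family `(A_i,B_i,C_i)` in `H`: `Σ_i (|A_i||B_i||C_i|)^{2.47/3} ≤ |H|`, stated on
`NoAbelianSTPPHostUpTo (247/100) 627`.  Assembly: `|H| ≤ 476` by vp-p2 g3's `noAbelianSTPPHostUpTo_250_476` (T_E/476) and monotonicity in the exponent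
(`noAbelianSTPPHostUpTo_anti`, `2.47 ≤ 5/2`); `477 … 627` by `AbelianTECensus.sieveSound`, `u11GSound_holds`, `TAKnap575.e3Adm_of_isSTPP` (the shape data of an
STPP family with non-empty sets is `SieveAdmissible`, `U11G` and `E3Adm`) and the arithmetic exclusion `TDStat.not_beats_247` — theory g11/g12's STATIC t*-indexed
linear certificate (`AbelianSTPPCensusTAStatDefs.lean`, range-C variant) instantiated at `τ = 247/100`, universe `627`, orders `477 … 627`
(`AbelianSTPPCensusTDStat{Defs,Rows,Sound}.lean`, table `…TDStatData`, gains `…TDGainTable247`), whose Boolean checks are evaluated by the kernel in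
`…TDStatDom` / `…TDStatCk` (`decide +kernel`, standard axioms, no `native_decide`; 2 499 sorted candidate shapes, 80 681 (shape, bucket) checks) and tiled here
(`dom_all`, `ck_all`).  Why the linear certificate reaches `627` for T_D while the `5/2` column needed a DFS: a `2.47`-beating list needs ≈ 6 % more volume per
order, and below `628` the vM caps (U11, U14), the E3 cap and one Grynkiewicz budget at the t*-bucket bound the companions of the maximal member; the same
relaxation first fails at order `629` (cell `(6,8,8)`, `V = 384`; exact twin calc/tdstat/ of theory's tastat2.py).
Census reading (HOME/KILL-MEMO §0/§8): the T_D KERNEL column moves `476 → 627`; the T_D number of record stays the instrument value `648` (vP, one lineage,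
`M*(T_D; vP)`) with the vQ bracket `(654, 680]` — this file says nothing about `628 … 647`.
WHAT THIS IS NOT: no bound on `ω`; rung-leaf class (a finite range of a necessary condition); no existence claim; nothing about orders `≥ 628`, about
non-abelian hosts, or about the `5/2` column (which stays at `476`, first vQK-alive `477`).
-/

set_option linter.dupNamespace false -- `MatrixMultiplication.MatrixMultiplication` (summit = problem, D-0017)
set_option autoImplicit false

namespace Summit.MatrixMultiplication.MatrixMultiplication.Theorems

namespace TDStat

open ShapeCert (gainOfTD)

/-- every sorted candidate shape of every volume `1 … 627` is dominated by the table (the `dom*` kernel chunks, tiled) -/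
theorem dom_all : ∀ V, 1 ≤ V → V ≤ 627 → ∀ x ∈ triplesS V, domX V (gainOfTD V) x = true := by
  intro V h1 h2
  by_cases c1 : V ≤ 224
  · exact domV_sound _ _ dom1 V (by omega) (by omega)
  by_cases c225 : V ≤ 407
  · exact domV_sound _ _ dom225 V (by omega) (by omega)
  exact domV_sound _ _ dom408 V (by omega) (by omega)

/-- every sorted candidate shape of every volume `1 … 627` passes `checkShape` (the `ck*` kernel chunks, tiled) -/
theorem ck_all : ∀ V, 1 ≤ V → V ≤ 627 → ∀ x ∈ triplesS V, checkShape V (gainOfTD V) x = true := by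
  intro V h1 h2
  by_cases c1 : V ≤ 287
  · exact checkV_sound _ _ ck1 V (by omega) (by omega)
  by_cases c288 : V ≤ 433
  · exact checkV_sound _ _ ck288 V (by omega) (by omega)
  exact checkV_sound _ _ ck434 V (by omega) (by omega)

/-- **T_D arithmetic exclusion, orders `477 … 627`.** No shape list with at least two members that is `SieveAdmissible M`, `U11G M` and
`TAKnap575.E3Adm M` beats `τ = 247/100` at an order `477 ≤ M ≤ 627`. [original] -/
theorem not_beats_247 (N M : ℕ) (a b c : Fin N → ℕ) (hN : 2 ≤ N) (h1 : 477 ≤ M) (h2 : M ≤ 627)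
    (hS : SieveAdmissible M a b c) (hG : U11G M a b c) (hE : TAKnap575.E3Adm M a b c) : ¬ Beats (247 / 100) M a b c :=
  not_beats_of_cert mono_ok dom_all ck_all hN h1 h2 hS hG hE

end TDStat

/-- **T_D/476, inherited.** No abelian STPP host of order `≤ 476` beats `2.47`: the T_E/476 leaf (`noAbelianSTPPHostUpTo_250_476`, vp-p2 g3) and
monotonicity of the range bound in the exponent (`noAbelianSTPPHostUpTo_anti`, `247/100 ≤ 5/2`). [bookkeeping] -/
theorem noAbelianSTPPHostUpTo_247_476 : NoAbelianSTPPHostUpTo (247 / 100) 476 :=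
  noAbelianSTPPHostUpTo_anti (τ := 247 / 100) (τ' := 5 / 2) (by norm_num) (by norm_num) noAbelianSTPPHostUpTo_250_476

/-- **T_D/627.** No abelian STPP host of order `≤ 627` beats the exponent `2.47`: `Σ_i (|A_i||B_i||C_i|)^{2.47/3} ≤ |H|` for every STPP family in every
finite abelian group `H` with `|H| ≤ 627`.  Orders `≤ 476`: `noAbelianSTPPHostUpTo_247_476`; orders `477 … 627`: `AbelianTECensus.sieveSound`,
`u11GSound_holds`, `TAKnap575.e3Adm_of_isSTPP` and `TDStat.not_beats_247`.
WHAT THIS IS NOT: no bound on `ω`; rung-leaf class; nothing about orders `≥ 628` or non-abelian hosts. [original] -/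
theorem noAbelianSTPPHostUpTo_247_627 : NoAbelianSTPPHostUpTo (247 / 100) 627 := by
  classical
  refine AbelianTECensus.noAbelianSTPPHostUpTo_of_two (τ := 247 / 100) (by norm_num) (by norm_num) ?_
  intro H _ _ hM N A B C hS hne hN
  by_cases h476 : Fintype.card H ≤ 476
  · exact noAbelianSTPPHostUpTo_247_476 H h476 N A B C hS
  · have hadm := AbelianTECensus.sieveSound H N A B C hS hne
    have hG := u11GSound_holds H N A B C hS hne
    have he3 := TAKnap575.e3Adm_of_isSTPP hS hne
    have h := TDStat.not_beats_247 N (Fintype.card H) _ _ _ hN (by omega) hM hadm hG he3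
    unfold Beats at h
    rw [not_lt] at h
    simpa [shapeVol] using h

end Summit.MatrixMultiplication.MatrixMultiplication.Theorems
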